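import Mathlib.MeasureTheory.Integral.Marginal
import Mathlib.MeasureTheory.Measure.WithDensity

/-!
# Atoms of a statistic decomposed along the active set of blocks

Helper for stub `stub_spreadFromPartsR3` (S6′, reshape r3) of line `free-volume-heavy-witness`
(crux `Summit.QuantumFields.QCD.Theses.SpectralDefectExtinction.WindowExtinction`,
item stmt-QuantumFields-8964).  Pure measure theory, no project vocabulary.

On a finite product `ι → α` with a product reference measure and a density `ρ`, blocks of coordinates
are indexed by `K`; block `i` has a "content" `κ i U` and is ACTIVE when the content lies in `A`; the
links of a set `S₀` of blocks are `E S₀`, and the contents of the blocks outside `S₀` do not see a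
refill of `E S₀` (locality).  `spreadR3_atom_decomp`: if on every fibre `{refills of E S₀}` with
`|S₀| ≥ m` the part of the weight where all blocks of `S₀` are active and `X = j` is at most `η` times
the part where all blocks of `S₀` are active, then the weight of `{at least m active blocks, X = j}` is
at most `η` times the total weight — decompose by the value `S₀` of the active set, integrate out the
links of `S₀` first (Mathlib `lmarginal`), and resum (the events `{active set = S₀}` are disjoint).
-/

noncomputable section

namespace Summit.QuantumFields.QCD.Cruxes.WindowExtinction.FreeVolumeHeavyWitness

open MeasureTheory Set Function
open scoped ENNReal BigOperators Classical

variable {ι α T K : Type*} [Fintype ι] [DecidableEq ι] [MeasurableSpace α] [MeasurableSpace T]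
  [Fintype K] [DecidableEq K]

omit [Fintype K] [DecidableEq K] [MeasurableSpace T] in
/-- The active set equals `S₀` iff activity is membership in `S₀`. -/
theorem spreadR3_filter_eq_iff (κ : K → T) (A : Set T) (S₀ : Finset K) [Fintype K] :
    (Finset.univ.filter fun i => κ i ∈ A) = S₀ ↔ ∀ i, (κ i ∈ A ↔ i ∈ S₀) := by
  simp only [Finset.ext_iff, Finset.mem_filter, Finset.mem_univ, true_and]

omit [Fintype ι] [DecidableEq ι] [MeasurableSpace α] [DecidableEq K] [MeasurableSpace T] in
/-- The events `{active set = S₀}` are disjoint: summing their indicators over any family of sets `S₀`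
gives at most the function itself. -/
theorem spreadR3_sum_indicator_filter_le (κ : K → (ι → α) → T) (A : Set T)
    (F : Finset (Finset K)) (ρ : (ι → α) → ℝ≥0∞) (U : ι → α) :
    ∑ S₀ ∈ F, {U | (Finset.univ.filter fun i => κ i U ∈ A) = S₀}.indicator ρ U ≤ ρ U := by
  set act := Finset.univ.filter fun i => κ i U ∈ A with hact
  have hzero : ∀ S₀, S₀ ≠ act →
      {U | (Finset.univ.filter fun i => κ i U ∈ A) = S₀}.indicator ρ U = 0 := fun S₀ hS₀ => by
    refine Set.indicator_of_notMem ?_ _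
    simp only [Set.mem_setOf_eq]
    exact fun h => hS₀ h.symm
  by_cases hF : act ∈ F
  · rw [Finset.sum_eq_single_of_mem act hF (fun S₀ _ hS₀ => hzero S₀ hS₀)]
    exact Set.indicator_apply_le' (fun _ => le_rfl) (fun _ => zero_le)
  · rw [Finset.sum_eq_zero (fun S₀ hS₀ => hzero S₀ (fun h => hF (h ▸ hS₀)))]
    exact zero_le

/-- **Atoms decomposed along the active set** (see the module docstring). -/
theorem spreadR3_atom_decomp :
    ∀ {ι α T K : Type*} [Fintype ι] [DecidableEq ι] [MeasurableSpace α] [MeasurableSpace T]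
      [Fintype K] (μ₀ : Measure α) [SigmaFinite μ₀]
      {κ : K → (ι → α) → T}, (∀ i, Measurable (κ i)) → ∀ {A : Set T}, MeasurableSet A →
      ∀ {ρ : (ι → α) → ℝ≥0∞}, Measurable ρ → ∀ {X : (ι → α) → ℤ}, Measurable X →
      ∀ (E : Finset K → Finset ι),
      (∀ (S₀ : Finset K) (i : K), i ∉ S₀ → ∀ (x : ι → α) (y : ↥(E S₀) → α),
        κ i (updateFinset x (E S₀) y) = κ i x) →
      ∀ {m : ℕ} {η : ℝ≥0∞} (j : ℤ),
      (∀ S₀ : Finset K, m ≤ S₀.card → ∀ x : ι → α,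
        ∫⁻ y, (if (∀ i ∈ S₀, κ i (updateFinset x (E S₀) y) ∈ A) ∧ X (updateFinset x (E S₀) y) = j
            then ρ (updateFinset x (E S₀) y) else 0) ∂(Measure.pi fun _ : ↥(E S₀) => μ₀) ≤
          η * ∫⁻ y, (if (∀ i ∈ S₀, κ i (updateFinset x (E S₀) y) ∈ A)
            then ρ (updateFinset x (E S₀) y) else 0) ∂(Measure.pi fun _ : ↥(E S₀) => μ₀)) →
      ((Measure.pi fun _ : ι => μ₀).withDensity ρ)
          {U | m ≤ (Finset.univ.filter fun i => κ i U ∈ A).card ∧ X U = j} ≤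
        η * ((Measure.pi fun _ : ι => μ₀).withDensity ρ) Set.univ := by
  intro ι α T K _ _ _ _ _ μ₀ _ κ hκ A hA ρ hρm X hX E hloc m η j hfib
  set π : Measure (ι → α) := Measure.pi fun _ : ι => μ₀ with hπ
  set act : (ι → α) → Finset K := fun U => Finset.univ.filter fun i => κ i U ∈ A with hact
  set F : Finset (Finset K) := Finset.univ.filter fun S₀ => m ≤ S₀.card with hF
  -- measurability of the events
  have hactm : ∀ S₀ : Finset K, MeasurableSet {U | act U = S₀} := by
    intro S₀
    have : {U | act U = S₀} = ⋂ i : K, {U | κ i U ∈ A ↔ i ∈ S₀} := by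
      ext U
      simp only [Set.mem_setOf_eq, Set.mem_iInter, hact, spreadR3_filter_eq_iff]
    rw [this]
    refine MeasurableSet.iInter fun i => ?_
    by_cases hi : i ∈ S₀
    · have : {U : ι → α | κ i U ∈ A ↔ i ∈ S₀} = κ i ⁻¹' A := by
        ext U; simp [hi]
      rw [this]; exact hκ i hA
    · have : {U : ι → α | κ i U ∈ A ↔ i ∈ S₀} = (κ i ⁻¹' A)ᶜ := by
        ext U; simp [hi]
      rw [this]; exact (hκ i hA).compl
  have hXj : MeasurableSet {U : ι → α | X U = j} := hX (measurableSet_singleton j)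
  have hAm : ∀ S₀ : Finset K, MeasurableSet {U | act U = S₀ ∧ X U = j} := fun S₀ =>
    (hactm S₀).inter hXj
  -- Step 1: cover by the values of the active set
  have hcover : {U | m ≤ (act U).card ∧ X U = j} ⊆ ⋃ S₀ ∈ F, {U | act U = S₀ ∧ X U = j} := by
    intro U hU
    obtain ⟨hm, hx⟩ := hU
    refine Set.mem_iUnion₂.2 ⟨act U, ?_, rfl, hx⟩
    simp only [hF, Finset.mem_filter, Finset.mem_univ, true_and]
    exact hm
  -- Step 2: each piece, fibrewise over the links of `S₀`
  have hpiece : ∀ S₀ ∈ F, π.withDensity ρ {U | act U = S₀ ∧ X U = j} ≤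
      η * ∫⁻ U, {U | act U = S₀}.indicator ρ U ∂π := by
    intro S₀ hS₀
    have hmS₀ : m ≤ S₀.card := by
      simp only [hF, Finset.mem_filter, Finset.mem_univ, true_and] at hS₀; exact hS₀
    rw [withDensity_apply _ (hAm S₀), ← lintegral_indicator (hAm S₀),
      ← lintegral_const_mul η (hρm.indicator (hactm S₀))]
    refine lintegral_le_of_lmarginal_le (μ := fun _ : ι => μ₀) (E S₀) (hρm.indicator (hAm S₀))
      ((hρm.indicator (hactm S₀)).const_mul η) (fun x => ?_)
    simp only [lmarginal]
    by_cases hout : ∀ i, i ∉ S₀ → κ i x ∉ A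
    · -- the blocks outside `S₀` are inactive along the whole fibre
      have hiff : ∀ y : ↥(E S₀) → α,
          act (updateFinset x (E S₀) y) = S₀ ↔ ∀ i ∈ S₀, κ i (updateFinset x (E S₀) y) ∈ A := by
        intro y
        rw [hact, spreadR3_filter_eq_iff]
        constructor
        · intro h i hi; exact (h i).2 hi
        · intro h i
          refine ⟨fun hiA => ?_, h i⟩
          by_contra hi
          rw [hloc S₀ i hi x y] at hiA
          exact hout i hi hiA
      have hL : ∀ y : ↥(E S₀) → α,
          {U | act U = S₀ ∧ X U = j}.indicator ρ (updateFinset x (E S₀) y) =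
            (if (∀ i ∈ S₀, κ i (updateFinset x (E S₀) y) ∈ A) ∧ X (updateFinset x (E S₀) y) = j
              then ρ (updateFinset x (E S₀) y) else 0) := by
        intro y
        simp only [Set.indicator, Set.mem_setOf_eq, hiff y]
      have hR : ∀ y : ↥(E S₀) → α,
          η * {U | act U = S₀}.indicator ρ (updateFinset x (E S₀) y) =
            η * (if (∀ i ∈ S₀, κ i (updateFinset x (E S₀) y) ∈ A)
              then ρ (updateFinset x (E S₀) y) else 0) := by
        intro y
        simp only [Set.indicator, Set.mem_setOf_eq, hiff y]
      have hmeas : Measurable fun y : ↥(E S₀) → α =>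
          (if (∀ i ∈ S₀, κ i (updateFinset x (E S₀) y) ∈ A)
            then ρ (updateFinset x (E S₀) y) else 0) := by
        refine Measurable.ite ?_ (hρm.comp measurable_updateFinset) measurable_const
        have h := Finset.measurableSet_biInter S₀
          (fun i (_ : i ∈ S₀) => ((hκ i).comp (measurable_updateFinset (s := E S₀) (x := x))) hA)
        convert h using 1
        ext y
        simp only [Set.mem_setOf_eq, Set.mem_iInter, Set.mem_preimage, Function.comp_apply]
      simp only [hL, hR]
      rw [lintegral_const_mul η hmeas]
      exact hfib S₀ hmS₀ x
    · -- some block outside `S₀` is active: the event is empty along the fibre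
      push Not at hout
      obtain ⟨i, hi, hiA⟩ := hout
      have hL0 : ∀ y : ↥(E S₀) → α,
          {U | act U = S₀ ∧ X U = j}.indicator ρ (updateFinset x (E S₀) y) = 0 := by
        intro y
        apply Set.indicator_of_notMem
        simp only [Set.mem_setOf_eq, not_and]
        intro hS
        exfalso
        rw [hact, spreadR3_filter_eq_iff] at hS
        have := (hS i).1 (by rw [hloc S₀ i hi x y]; exact hiA)
        exact hi this
      simp only [hL0, lintegral_const, zero_mul, zero_le]
  -- Step 3: resum
  calc π.withDensity ρ {U | m ≤ (act U).card ∧ X U = j}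
      ≤ π.withDensity ρ (⋃ S₀ ∈ F, {U | act U = S₀ ∧ X U = j}) := measure_mono hcover
    _ ≤ ∑ S₀ ∈ F, π.withDensity ρ {U | act U = S₀ ∧ X U = j} := measure_biUnion_finset_le _ _
    _ ≤ ∑ S₀ ∈ F, η * ∫⁻ U, {U | act U = S₀}.indicator ρ U ∂π := Finset.sum_le_sum hpiece
    _ = η * ∫⁻ U, ∑ S₀ ∈ F, {U | act U = S₀}.indicator ρ U ∂π := by
        rw [← Finset.mul_sum, lintegral_finsetSum _ fun S₀ _ => hρm.indicator (hactm S₀)]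
    _ ≤ η * ∫⁻ U, ρ U ∂π := by
        gcongr with U
        exact spreadR3_sum_indicator_filter_le κ A F ρ U
    _ = η * π.withDensity ρ Set.univ := by
        rw [withDensity_apply _ MeasurableSet.univ, Measure.restrict_univ]

end Summit.QuantumFields.QCD.Cruxes.WindowExtinction.FreeVolumeHeavyWitness

end
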